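import Literature.AnabelianGeometry.EtaleTheta.Discharge.Sec5ThetaSubquotientAutLaws
import Literature.AnabelianGeometry.EtaleTheta.Discharge.Sec5ThetaSubquotientRhoOfConnectedTemperoid
import Literature.AnabelianGeometry.EtaleTheta.Discharge.Sec5TransportLaws

/-!
# [EtTh] §5: print's image subquotient `(l·Δ_Θ)_E ⊆ Aut^Θ_D(E)` as a `ThetaSubquotientStub` over `B^temp(Π)⁰`,
# and the TERM of `ThetaSubquotientProj` it carries at every object (non-vacuity of the `P` binder)

Mochizuki, *The étale theta function and its Frobenioid-theoretic manifestations*, Publ. RIMS **45** (2009), §5 p. 327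
(PDF p. 101): "these subquotients determine subquotients `Aut_D(D) ↠ Aut^Θ_D(D)`; `(l·Δ_Θ)_D ⊆ Aut^Θ_D(D)`" — in print,
`(l·Δ_Θ)_D` is, at EVERY object `D` of the base category, a subquotient OF `Aut_D(D)`.
[cite: MochizukiEtTh2009, §5 p.327 (PDF p.101)]

abc-iut cell, seat abc-iut-w5-d020 (gen 4); offer O2 to abc-iut-L2-lead (NV-L2/`ThetaSubquotientProj`).  CONTEXT (kernel facts of
record, nothing new asserted): abc-iut-L2-t4's FROZEN record `FrobenioidCyclotomicRigidity.ThetaSubquotientProj 𝔉` (the binder `P` of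
the whole Prop. 5.5 / Thm. 5.6 chain) asks for `proj E : pre E →* 𝔉.lDelta E` SURJECTIVE at every object `E`; for abc-iut-L2-t9's
carrier `thetaSubquotientStub q ι` (reading R2: compatible families modulo null ones — print's subquotient at GALOIS objects, a
coinvariant ENLARGEMENT of it elsewhere) print's `autProj` is onto only at Galois objects (abc-iut-w4-d042
`autProj_surjective_of_isGaloisObj`), and `ThetaSubquotientProj` is EMPTY as soon as a rigid object has non-trivial carrier
(abc-iut-w5-d029 `isEmpty_of_rigid_of_nontrivial`; GAP-LEDGER G-w4d042g3-1).  Since `FrobenioidTheta.ThetaSubquotientStub` records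
NO functoriality law (fields `lDelta`, `lDeltaMap` only) and the stub `Q` is a FREE parameter of the genuine §5 data
(`ThetaFrobenioid.ofBiKummerData … Q …`, `toThetaSubquotientStub := Q`), the vacuity is a property of the carrier choice.  Here:

* `ThetaSubquotient.autImage q ι E := (autProj q ι E).range ≤ LDelta q ι E` — print's OWN carrier, the image of print's
  `Aut`-subgroup `autPre E` ("automorphisms given by `l·Δ_Θ`") in abc-iut-L2-t9's `(l·Δ_Θ)_E`; `= ⊤` at Galois objects
  (`autImage_eq_top_of_isGaloisObj`), so at `B_N^bs` and at every root codomain it is abc-iut-L2-t9's carrier up to `Subgroup.topEquiv`;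
* `ThetaSubquotient.autImageStub q ι : ThetaSubquotientStub (ConnectedPart (BTemp G))` — `lDelta E := autImage q ι E.obj`, `lDeltaMap f :=`
  the restriction of abc-iut-L2-t9's push-forward `map … f.hom` whenever it carries images into images (in particular whenever the target
  is Galois — `autImageStub_lDeltaMap_coe_of_isGaloisObj`), and the trivial homomorphism otherwise (print induces maps on these
  subquotients along the morphisms it uses — linear morphisms of theta-saturated, hence Galois-based, objects, Prop. 5.5 p. 327–328; the
  record asks for a bare function and abc-iut-L2-t9's finding W2-L2-05/B is that `Aut_D(−)`-images are not functorial along ALL morphisms);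
* `ThetaSubquotient.autImagePre q ι E ≤ Aut_{B^temp(Π)⁰}(E)` / `autImageProj q ι E : autImagePre E →* autImage E.obj` — print's
  `P_E ↠ (l·Δ_Θ)_E` read through the fully faithful inclusion `B^temp(Π)⁰ ⥤ B^temp(Π)`, ONTO AT EVERY OBJECT BY CONSTRUCTION
  (`autImageProj_surjective`), whence the term `ThetaSubquotient.thetaSubquotientProjOfAutImage 𝔉 h𝔉 : ThetaSubquotientProj 𝔉` for every
  theta-Frobenioid `𝔉` over `B^temp(Π)⁰` whose subquotient stub IS `autImageStub q ι`, and `Nonempty (ThetaSubquotientProj 𝔉)`.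

So every theorem of the Prop. 5.5 / Thm. 5.6 chain instantiated at `Q := autImageStub q ι` has an inhabited `P` binder; the on-the-nose
repair for `Q := thetaSubquotientStub q ι` (v-next field `proj_surjective_of_isGaloisObj`) is abc-iut-L2-t4's and is not pre-empted here.
DEFINITIONS of DATA only (a carrier choice and its projection) + their evaluation lemmas; no `Prop`-valued fact; nothing of [EtTh] is
asserted; typed ≠ proved; no side taken on [IUTchIII] Cor. 3.12.
-/

noncomputable section

namespace Literature.AnabelianGeometry.EtaleTheta

namespace ThetaSubquotient

open CategoryTheory Literature.AlgebraicGeometry.Frobenioids Literature.AnabelianGeometry.SemiGraphs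
open FrobenioidCyclotomicRigidity

universe u v w uC vC

variable {G : Type u} [Group G] [TopologicalSpace G] {Q : Type v} [Group Q] {Λ : Type w}
  [CommGroup Λ] (q : G →* Q) (ι : Λ →* Q)

/-! ### Print's `Aut`-subgroup `P_E` read in `B^temp(Π)⁰` -/

/-- Print's `Aut`-subgroup `P_E` ("automorphisms given by `l·Δ_Θ`", abc-iut-L2-t9's `autPre`) read in `Aut_{B^temp(Π)⁰}(E)` through
the fully faithful inclusion `B^temp(Π)⁰ ⥤ B^temp(Π)`.  [cite: MochizukiEtTh2009, §5 p.327 (PDF p.101)] -/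
def autImagePre (E : ConnectedPart (BTemp G)) : Subgroup (Aut E) :=
  (autPre q ι E.obj).comap ((connectedObjects (BTemp G)).fullyFaithfulι.autMulEquivOfFullyFaithful E).toMonoidHom

/-- Membership in `autImagePre`: the underlying automorphism of the `Π`-set lies in `autPre`. [cite: MochizukiEtTh2009, §5 p.327 (PDF p.101)] -/
theorem mem_autImagePre_iff (E : ConnectedPart (BTemp G)) (σ : Aut E) :
    σ ∈ autImagePre q ι E ↔ (connectedObjects (BTemp G)).fullyFaithfulι.autMulEquivOfFullyFaithful E σ ∈ autPre q ι E.obj :=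
  Iff.rfl

/-- Membership in `autImagePre`, `Functor.mapAut` form (the shape of abc-iut-w4-d042's genuine-`ρ` laws,
`Discharge/Sec5ThetaSubquotientRhoOfConnectedTemperoid.lean`). [cite: MochizukiEtTh2009, §5 p.327 (PDF p.101)] -/
theorem mem_autImagePre_iff_mapAut (E : ConnectedPart (BTemp G)) (σ : Aut E) :
    σ ∈ autImagePre q ι E ↔ Functor.mapAut E (connectedObjects (BTemp G)).ι σ ∈ autPre q ι E.obj :=
  Iff.rfl

/-- `P_E → autPre (E.obj)`, the inclusion read on underlying automorphisms (a restriction of the `Aut`-equivalence of the fully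
faithful inclusion).  [cite: MochizukiEtTh2009, §5 p.327 (PDF p.101)] -/
def autImagePreToAutPre (E : ConnectedPart (BTemp G)) : autImagePre q ι E →* autPre q ι E.obj :=
  (((connectedObjects (BTemp G)).fullyFaithfulι.autMulEquivOfFullyFaithful E).toMonoidHom.comp (autImagePre q ι E).subtype).codRestrict
    (autPre q ι E.obj) fun σ => σ.2

/-- `autImagePreToAutPre` is onto (the `Aut`-equivalence is). [cite: MochizukiEtTh2009, §5 p.327 (PDF p.101)] -/
theorem autImagePreToAutPre_surjective (E : ConnectedPart (BTemp G)) : Function.Surjective (autImagePreToAutPre q ι E) := by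
  rintro ⟨σ, hσ⟩
  refine ⟨⟨((connectedObjects (BTemp G)).fullyFaithfulι.autMulEquivOfFullyFaithful E).symm σ, ?_⟩, ?_⟩
  · change (connectedObjects (BTemp G)).fullyFaithfulι.autMulEquivOfFullyFaithful E
      (((connectedObjects (BTemp G)).fullyFaithfulι.autMulEquivOfFullyFaithful E).symm σ) ∈ autPre q ι E.obj
    rwa [MulEquiv.apply_symm_apply]
  · apply Subtype.ext
    change (connectedObjects (BTemp G)).fullyFaithfulι.autMulEquivOfFullyFaithful E
      (((connectedObjects (BTemp G)).fullyFaithfulι.autMulEquivOfFullyFaithful E).symm σ) = σ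
    rw [MulEquiv.apply_symm_apply]

variable [ι.range.Normal]

/-! ### Print's carrier: the image of `autPre E` in `(l·Δ_Θ)_E` -/

/-- **Print's `(l·Δ_Θ)_E ⊆ Aut^Θ_D(E)`** as a subgroup of abc-iut-L2-t9's carrier: the image of print's `Aut`-subgroup
`autPre q ι E` under `autProj`.  [cite: MochizukiEtTh2009, §5 p.327 (PDF p.101)] -/
abbrev autImage (E : BTemp G) : Subgroup (LDelta q ι E) := (autProj q ι E).range

/-- At a Galois object print's image is ALL of `(l·Δ_Θ)_E` (for `q` surjective): there abc-iut-L2-t9's carrier and print's agree.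
[cite: MochizukiEtTh2009, §5 p.327 (PDF p.101)] -/
theorem autImage_eq_top_of_isGaloisObj [IsTopologicalGroup G] (hG : IsTempered G) (A : BTemp G) (hA : IsGaloisObj A)
    (hq : Function.Surjective q) : autImage q ι A = ⊤ :=
  MonoidHom.range_eq_top.mpr (autProj_surjective_of_isGaloisObj q ι hG A hA hq)

/-- The transport of print's images along a morphism `f : E → E'` of connected objects: abc-iut-L2-t9's push-forward `map … f`
restricted to the images WHEN it carries `autImage E` into `autImage E'` (always the case for a Galois target,
`coe_autImageMap_of_isGaloisObj`), and — HONESTY NOTE — the trivial homomorphism `1` as a JUNK VALUE otherwise: outside the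
image-preserving locus this is NOT a law and no consumer may read it as one (the record `ThetaSubquotientStub` asks for a bare
function; print induces maps on these subquotients only along the Galois/linear locus it uses, Prop. 5.5 p.327–328, and
abc-iut-L2-t9's finding W2-L2-05/B is that `Aut_D(−)`-images are not functorial along all morphisms).
[cite: MochizukiEtTh2009, Prop 5.5 proof p.328 (PDF p.102)] -/
def autImageMap {E E' : BTemp G} (hE : IsConnectedObj E) (hE' : IsConnectedObj E') (f : E ⟶ E') :
    autImage q ι E →* autImage q ι E' := by
  classical
  exact if h : (autImage q ι E).map (map q ι hE hE' f) ≤ autImage q ι E' then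
    ((map q ι hE hE' f).comp (autImage q ι E).subtype).codRestrict (autImage q ι E') fun x => h ⟨x, x.2, rfl⟩
  else 1

/-- When the push-forward carries images into images, `autImageMap f` IS abc-iut-L2-t9's `map … f` on the image.
[cite: MochizukiEtTh2009, Prop 5.5 proof p.328 (PDF p.102)] -/
theorem coe_autImageMap_of_le {E E' : BTemp G} (hE : IsConnectedObj E) (hE' : IsConnectedObj E') (f : E ⟶ E')
    (h : (autImage q ι E).map (map q ι hE hE' f) ≤ autImage q ι E') (x : autImage q ι E) :
    (autImageMap q ι hE hE' f x : LDelta q ι E') = map q ι hE hE' f x := by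
  unfold autImageMap
  rw [dif_pos h]
  rfl

/-- When the TARGET is Galois (and `q` is onto) the push-forward always carries images into images, so `autImageMap f` is
abc-iut-L2-t9's `map … f` on the image — the case of the root codomains / `B_N^bs` of §5.  [cite: MochizukiEtTh2009, Prop 5.5 proof p.328 (PDF p.102)] -/
theorem coe_autImageMap_of_isGaloisObj [IsTopologicalGroup G] (hG : IsTempered G) {E E' : BTemp G} (hE : IsConnectedObj E)
    (hE' : IsGaloisObj E') (hq : Function.Surjective q) (f : E ⟶ E') (x : autImage q ι E) :
    (autImageMap q ι hE hE'.1 f x : LDelta q ι E') = map q ι hE hE'.1 f x :=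
  coe_autImageMap_of_le q ι hE hE'.1 f (by rw [autImage_eq_top_of_isGaloisObj q ι hG E' hE' hq]; exact le_top) x

/-! ### The stub over `B^temp(Π)⁰` with print's carrier -/

/-- **The theta subquotients over `D = B^temp(Π)⁰` with PRINT's carrier** `(l·Δ_Θ)_E := Im(P_E → carrier)`, as an instance of
abc-iut-L2-t4's `FrobenioidTheta.ThetaSubquotientStub D` (an alternative to abc-iut-L2-t9's `thetaSubquotientStub q ι`, with which it
agrees at Galois objects up to `Subgroup.topEquiv`).  [cite: MochizukiEtTh2009, §5 p.327 (PDF p.101)] -/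
def autImageStub : FrobenioidTheta.ThetaSubquotientStub.{max u w} (ConnectedPart (BTemp G)) where
  lDelta E := autImage q ι E.obj
  instCommGroupLDelta _ := inferInstance
  lDeltaMap {E E'} f := autImageMap q ι E.property E'.property f.hom

/-- The carrier of the stub at `E` is print's image (definitionally). [cite: MochizukiEtTh2009, §5 p.327 (PDF p.101)] -/
theorem autImageStub_lDelta (E : ConnectedPart (BTemp G)) : (autImageStub q ι).lDelta E = autImage q ι E.obj := rfl

/-- The transport of the stub is `autImageMap` (definitionally). [cite: MochizukiEtTh2009, §5 p.327 (PDF p.101)] -/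
theorem autImageStub_lDeltaMap {E E' : ConnectedPart (BTemp G)} (f : E ⟶ E') :
    (autImageStub q ι).lDeltaMap f = autImageMap q ι E.property E'.property f.hom := rfl

/-- Along a morphism of `B^temp(Π)⁰` with Galois target the stub transports by abc-iut-L2-t9's `map` (read in its carrier).
[cite: MochizukiEtTh2009, Prop 5.5 proof p.328 (PDF p.102)] -/
theorem autImageStub_lDeltaMap_coe_of_isGaloisObj [IsTopologicalGroup G] (hG : IsTempered G) {E E' : ConnectedPart (BTemp G)}
    (hE' : IsGaloisObj E'.obj) (hq : Function.Surjective q) (f : E ⟶ E') (x : autImage q ι E.obj) :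
    (Subtype.val ((autImageStub q ι).lDeltaMap f x) : LDelta q ι E'.obj) = map q ι E.property E'.property f.hom x :=
  coe_autImageMap_of_isGaloisObj q ι hG E.property hE' hq f.hom x

/-! ### Print's `P_E ↠ (l·Δ_Θ)_E`: onto at every object -/

/-- **Print's projection `P_E ↠ (l·Δ_Θ)_E` onto its image carrier**, read in `B^temp(Π)⁰`. [cite: MochizukiEtTh2009, §5 p.327 (PDF p.101)] -/
def autImageProj (E : ConnectedPart (BTemp G)) : autImagePre q ι E →* autImage q ι E.obj :=
  (autProj q ι E.obj).rangeRestrict.comp (autImagePreToAutPre q ι E)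

/-- `autImageProj` computes as `autProj` of the underlying automorphism. [cite: MochizukiEtTh2009, §5 p.327 (PDF p.101)] -/
theorem coe_autImageProj (E : ConnectedPart (BTemp G)) (σ : autImagePre q ι E) :
    (autImageProj q ι E σ : LDelta q ι E.obj) =
      autProj q ι E.obj ⟨(connectedObjects (BTemp G)).fullyFaithfulι.autMulEquivOfFullyFaithful E σ, σ.2⟩ := rfl

/-- **Onto at EVERY object** (by construction: the carrier IS the image). [cite: MochizukiEtTh2009, §5 p.327 (PDF p.101)] -/
theorem autImageProj_surjective (E : ConnectedPart (BTemp G)) : Function.Surjective (autImageProj q ι E) :=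
  (autProj q ι E.obj).rangeRestrict_surjective.comp (autImagePreToAutPre_surjective q ι E)

/-! ### The term of `ThetaSubquotientProj` for every theta-Frobenioid over `B^temp(Π)⁰` carrying print's stub -/

variable {C : Type uC} [Category.{vC} C]

/-- **Non-vacuity of the `P` binder**: a theta-Frobenioid over `B^temp(Π)⁰` whose subquotient stub is `autImageStub q ι` carries print's
`(P_E ↠ (l·Δ_Θ)_E)_E` as a term of abc-iut-L2-t4's `ThetaSubquotientProj`.  [cite: MochizukiEtTh2009, §5 p.327 (PDF p.101)] -/
def thetaSubquotientProjOfAutImage (𝔉 : ThetaFrobenioid.{max u w} C (ConnectedPart (BTemp G)))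
    (h𝔉 : 𝔉.toThetaSubquotientStub = autImageStub q ι) : ThetaSubquotientProj 𝔉 := by
  cases 𝔉
  dsimp only at h𝔉
  subst h𝔉
  exact ⟨fun E => autImagePre q ι E, fun E => autImageProj q ι E, fun E => autImageProj_surjective q ι E⟩

end ThetaSubquotient

/-! ### At the GENUINE §5 data over `B^temp(Π^tp_X)⁰` (abc-iut-L2-t4's `ofConnectedTemperoidData`) with `Q := autImageStub q ι` -/

namespace ThetaFrobenioid

open CategoryTheory Opposite Literature.AlgebraicGeometry.Frobenioids Literature.AnabelianGeometry.SemiGraphs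
  Literature.AnabelianGeometry.SemiGraphs.GaloisObjects FrobenioidCyclotomicRigidity

universe u₀ v₀ w v'

variable {K : Type u₀} [Field K] {X : SemiGraphs.TemperedArithmeticGroup.{u₀} K} {D₀ : Type u₀} [Category.{v₀} D₀]
  {V : FrdIMonoidStub.{max u₀ w}} {T₀ : RealifiedDivisorMonoids (D₀ := D₀) V}
  {VD : FrdICatStub.{u₀ + 1, u₀, max u₀ w} (ConnectedPart (BTemp X.Pi))}
  {tf : TemperedFrobenioid T₀ (ConnectedPart (BTemp X.Pi)) VD} {hZ : tf.monoidType = MonoidType.Z}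
  {hP : ∀ A : (ConnectedPart (BTemp X.Pi))ᵒᵖ, IsPerfect (tf.Φ.carrier A)}
  {NH : Subgroup (Field.absoluteGaloisGroup K) → tf.category → ℕ+ → Prop} {A₀ : tf.category}
  {hA₀ : PreFrobenioid.IsFrobeniusTrivial tf.toElem A₀} {hA₀' : SemiGraphs.IsGaloisObj A₀.base.obj}
  {pullFrac : ∀ {A A' : (BiKummerSetting.mkOfConnectedTemperoid X tf hZ hP NH A₀ hA₀ hA₀').C} (_ : A' ⟶ A),
    (BiKummerSetting.mkOfConnectedTemperoid X tf hZ hP NH A₀ hA₀ hA₀').biratUnits A →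
      (BiKummerSetting.mkOfConnectedTemperoid X tf hZ hP NH A₀ hA₀ hA₀').biratUnits A'}
  {lv N : ℕ+} {T : ThetaEnvData.{max u₀ w} N}
  {θ : (BiKummerSetting.mkOfConnectedTemperoid X tf hZ hP NH A₀ hA₀ hA₀').biratUnits
    (BiKummerSetting.mkOfConnectedTemperoid X tf hZ hP NH A₀ hA₀ hA₀').Aodot}
  {Bl : (BiKummerSetting.mkOfConnectedTemperoid X tf hZ hP NH A₀ hA₀ hA₀').C}
  {Pl : (BiKummerSetting.mkOfConnectedTemperoid X tf hZ hP NH A₀ hA₀ hA₀').FractionPair θ Bl}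
  {Rl : (BiKummerSetting.mkOfConnectedTemperoid X tf hZ hP NH A₀ hA₀ hA₀').NthRoot θ Pl lv pullFrac}
  (h : ModelFrobenioid.Hypotheses tf.divisorMonoid tf.ratFnFunctor)
  {Q' : Type v'} [Group Q'] {Λ : Type w} [CommGroup Λ] (q : X.Pi →* Q') (ι : Λ →* Q') [ι.range.Normal]
  (odd_l : Odd (lv : ℕ))
  (R : (BiKummerSetting.mkOfConnectedTemperoid X tf hZ hP NH A₀ hA₀ hA₀').NthRoot Rl.root Rl.pair N pullFrac)
  (ιX : T.PiX ≃ₜ* X.Pi) (K' : Type (max u₀ w)) [Field K'] (constEmb : K'ˣ →* tf.biratUnitsModel R.BN)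
  (constEmb_injective : Function.Injective constEmb)
  (hinvc : ∀ g : Aut R.AN.base,
    pull tf.divisorMonoid g.hom (ModelFrobenioid.div R.pair.num) = ModelFrobenioid.div R.pair.num)
  (hinvp : ∀ y : T.PiX, y ∈ T.PiYdd →
    pull tf.divisorMonoid ((BiKummerSetting.mkOfConnectedTemperoid X tf hZ hP NH A₀ hA₀ hA₀').galoisSurj R.AN.base
      R.αData.isGalois (ιX y)).hom (ModelFrobenioid.div R.pair.den) = ModelFrobenioid.div R.pair.den)

/-- The subquotient stub of the genuine §5 data with `Q := autImageStub q ι` IS that stub (definitionally).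
[cite: MochizukiEtTh2009, §5 p.327 (PDF p.101)] -/
theorem ofConnectedTemperoidData_toThetaSubquotientStub_autImage :
    (ofConnectedTemperoidData h (ThetaSubquotient.autImageStub q ι) odd_l R ιX K' constEmb constEmb_injective hinvc
      hinvp).toThetaSubquotientStub = ThetaSubquotient.autImageStub q ι := rfl

/-- **The `P` binder of the Prop 5.5 / Thm 5.6 chain INHABITED at the genuine §5 data over `B^temp(Π^tp_X)⁰`** for the carrier choice
`Q := autImageStub q ι` (print's image subquotient): print's `(P_E ↠ (l·Δ_Θ)_E)_E` as a term of abc-iut-L2-t4's `ThetaSubquotientProj`.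
[cite: MochizukiEtTh2009, §5 p.327 (PDF p.101)] -/
def thetaSubquotientProjOfConnectedTemperoidDataAutImage :
    ThetaSubquotientProj (ofConnectedTemperoidData h (ThetaSubquotient.autImageStub q ι) odd_l R ιX K' constEmb
      constEmb_injective hinvc hinvp) :=
  ThetaSubquotient.thetaSubquotientProjOfAutImage q ι _ rfl

/-- Hence `ThetaSubquotientProj` of the genuine §5 data with print's carrier is NON-EMPTY (contrast abc-iut-w5-d029's
`ThetaSubquotientProj.isEmpty_of_rigid_of_nontrivial` for carriers that are non-trivial at a rigid object).
[cite: MochizukiEtTh2009, §5 p.327 (PDF p.101)] -/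
theorem nonempty_thetaSubquotientProj_ofConnectedTemperoidData_autImage :
    Nonempty (ThetaSubquotientProj (ofConnectedTemperoidData h (ThetaSubquotient.autImageStub q ι) odd_l R ιX K' constEmb
      constEmb_injective hinvc hinvp)) :=
  ⟨thetaSubquotientProjOfConnectedTemperoidDataAutImage h q ι odd_l R ιX K' constEmb constEmb_injective hinvc hinvp⟩

/-- `pre` of the term at an object `E` is print's `P_E` read in `B^temp(Π^tp_X)⁰` (`autImagePre`).
[cite: MochizukiEtTh2009, §5 p.327 (PDF p.101)] -/
theorem thetaSubquotientProjOfConnectedTemperoidDataAutImage_pre (E : ConnectedPart (BTemp X.Pi)) :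
    (thetaSubquotientProjOfConnectedTemperoidDataAutImage h q ι odd_l R ιX K' constEmb constEmb_injective hinvc hinvp).pre E =
      ThetaSubquotient.autImagePre q ι E := rfl

/-- `proj` of the term at an object `E`, read in abc-iut-L2-t9's carrier, is print's `autProj` of the underlying automorphism.
[cite: MochizukiEtTh2009, §5 p.327 (PDF p.101)] -/
theorem thetaSubquotientProjOfConnectedTemperoidDataAutImage_proj_coe (E : ConnectedPart (BTemp X.Pi))
    (σ : ThetaSubquotient.autImagePre q ι E) :
    (Subtype.val ((thetaSubquotientProjOfConnectedTemperoidDataAutImage h q ι odd_l R ιX K' constEmb constEmb_injective hinvc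
        hinvp).proj E σ) : ThetaSubquotient.LDelta q ι E.obj) =
      ThetaSubquotient.autProj q ι E.obj ⟨(connectedObjects (BTemp X.Pi)).fullyFaithfulι.autMulEquivOfFullyFaithful E σ, σ.2⟩ :=
  rfl

/-- Membership in `pre` of the term at `E`, in the `Functor.mapAut` form of abc-iut-w4-d042's genuine-`ρ` laws: so his
`mapAut_rho_mem_autPre_of_mem_range` (hpre), `evalAt_autProj_rhoOfBiKummerData` (hP at the base point), `autPre_le_map_mapAut_rhoOfBiKummerData`
(hgeom), `exists_lift_rho_of_mem_autPre` (hlift) are statements about THIS `P` (through `…_proj_coe`).  [cite: MochizukiEtTh2009, §5 p.327 (PDF p.101)] -/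
theorem mem_pre_thetaSubquotientProjOfConnectedTemperoidDataAutImage_iff (E : ConnectedPart (BTemp X.Pi)) (σ : Aut E) :
    σ ∈ (thetaSubquotientProjOfConnectedTemperoidDataAutImage h q ι odd_l R ιX K' constEmb constEmb_injective hinvc hinvp).pre E ↔
      Functor.mapAut E (connectedObjects (BTemp X.Pi)).ι σ ∈ ThetaSubquotient.autPre q ι E.obj :=
  Iff.rfl

end ThetaFrobenioid

/-! ## APPEND (abc-iut-w5-d020 gen 4, after p432202): the stub laws that DO hold for print's image carrier, and the DUAL CLAUSE

HONESTY / DUAL CLAUSE (structural note; the negative half is argued on paper, the positive half is proved below).  The Prop. 5.5 /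
Thm. 5.6 chain binds TWO ∀-form laws on the subquotient stub of `𝔉`: `P : ThetaSubquotientProj 𝔉` (projection ONTO the carrier at
EVERY object) and `hLc : Thm56Sub.LDeltaMapComp 𝔉` (`lDeltaMap` functorial along EVERY composable pair of the base).  For
abc-iut-L2-t9's functorial carrier `thetaSubquotientStub q ι` (R2) `hLc` is a theorem (`thetaSubquotientStub_lDeltaMap_comp`) and `P` is
EMPTY as soon as a rigid object has non-trivial carrier (abc-iut-w5-d029 `ThetaSubquotientProj.isEmpty_of_rigid_of_nontrivial`).  For
print's image carrier `autImageStub q ι` (this file) `P` is INHABITED (`thetaSubquotientProjOfAutImage`) but `LDeltaMapComp` in its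
∀-form is NOT expected: along a morphism from a Galois object `E = Π/N` onto a RIGID object `E′ = Π/H` (`N ≤ H`, `Aut E′ = 1`) whose
R2-carrier is non-trivial, the push-forward of the class of an automorphism of `E` given by an `m ∈ q⁻¹(ι Λ)` outside the stabilisers of
`E′` modulo `kill` is NOT a null family, while `autImage E′ = 1`; so images are not carried into images, `autImageMap` takes its junk
value there, and for `E ↠ E′ ↠ E″` with `E″` Galois `lDeltaMap (f ≫ g) = map (f ≫ g)|_{im} ≠ 1 = lDeltaMap g ∘ lDeltaMap f`.  Dually, a
carrier that IS functorial along all morphisms and agrees with print's at Galois objects and along the morphisms between them is forced,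
at such an `H ≤ N`, to surject onto the non-trivial carrier of the Galois object below it, so no subgroup of `Aut E′ = 1` projects onto it.
CONCLUSION (no side taken as to which is print's reading): at the genuine base the two ∀-clauses cannot both be theorems once
`B^temp(Π)⁰` has such a rigid-under-Galois object; exactly one of them has to be relativised to the locus print actually uses — the
linear morphisms of `(l, N)`-theta-saturated (Galois-based) objects, Prop. 5.5 p. 327–328 (PDF pp. 101–102): abc-iut-L2-t4's v-next
field `proj_surjective_of_isGaloisObj` (keep R2) is the choice of record (GAP-LEDGER G-w4d042g3-1); `LDeltaMapComp` along
image-preserving pairs (keep the image carrier) is the dual.  Below: what IS a theorem for the image carrier — `LDeltaMapId`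
(`autImageMap_id`), and functoriality along image-preserving pairs, in particular pairs with Galois targets
(`autImageMap_comp_of_le`, `autImageMap_comp_of_isGaloisObj`), i.e. on the root-codomain / `B_N^bs` locus of §5.
[cite: MochizukiEtTh2009, Prop 5.5 proof p.328 (PDF p.102)] -/

namespace ThetaSubquotient

open CategoryTheory Literature.AlgebraicGeometry.Frobenioids Literature.AnabelianGeometry.SemiGraphs
open FrobenioidCyclotomicRigidity

universe u' v'' w''

variable {G : Type u'} [Group G] [TopologicalSpace G] {Q : Type v''} [Group Q] {Λ : Type w''}
  [CommGroup Λ] (q : G →* Q) (ι : Λ →* Q) [ι.range.Normal]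

/-- The identity carries images into images (`ThetaSubquotient.map_id`, `Discharge/Sec5TransportLaws.lean`). [cite: MochizukiEtTh2009, Prop 5.5 proof p.328 (PDF p.102)] -/
theorem map_autImage_id_le {E : BTemp G} (hE : IsConnectedObj E) :
    (autImage q ι E).map (map q ι hE hE (𝟙 E)) ≤ autImage q ι E := by
  rw [map_id q ι hE, Subgroup.map_id]

/-- **`LDeltaMapId` for the image carrier**: `autImageMap (𝟙 E) = id`. [cite: MochizukiEtTh2009, Prop 5.5 proof p.328 (PDF p.102)] -/
theorem autImageMap_id {E : BTemp G} (hE : IsConnectedObj E) : autImageMap q ι hE hE (𝟙 E) = MonoidHom.id _ := by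
  refine MonoidHom.ext fun x => Subtype.ext ?_
  rw [coe_autImageMap_of_le q ι hE hE (𝟙 E) (map_autImage_id_le q ι hE), map_id q ι hE]
  rfl

/-- If `f` and `g` carry images into images then so does `f ≫ g` (`ThetaSubquotient.map_comp`, `Discharge/Sec5TransportLaws.lean`).
[cite: MochizukiEtTh2009, Prop 5.5 proof p.328 (PDF p.102)] -/
theorem map_autImage_comp_le {E E' E'' : BTemp G} (hE : IsConnectedObj E) (hE' : IsConnectedObj E') (hE'' : IsConnectedObj E'')
    (f : E ⟶ E') (g : E' ⟶ E'') (hf : (autImage q ι E).map (map q ι hE hE' f) ≤ autImage q ι E')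
    (hg : (autImage q ι E').map (map q ι hE' hE'' g) ≤ autImage q ι E'') :
    (autImage q ι E).map (map q ι hE hE'' (f ≫ g)) ≤ autImage q ι E'' := by
  rw [map_comp q ι hE hE' hE'' f g, ← Subgroup.map_map]
  exact (Subgroup.map_mono hf).trans hg

/-- **Functoriality of the image carrier along IMAGE-PRESERVING pairs**: if `f` and `g` carry images into images then
`autImageMap (f ≫ g) = autImageMap g ∘ autImageMap f` (all three maps are then abc-iut-L2-t9's `map`, which is functorial).
[cite: MochizukiEtTh2009, Prop 5.5 proof p.328 (PDF p.102)] -/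
theorem autImageMap_comp_of_le {E E' E'' : BTemp G} (hE : IsConnectedObj E) (hE' : IsConnectedObj E') (hE'' : IsConnectedObj E'')
    (f : E ⟶ E') (g : E' ⟶ E'') (hf : (autImage q ι E).map (map q ι hE hE' f) ≤ autImage q ι E')
    (hg : (autImage q ι E').map (map q ι hE' hE'' g) ≤ autImage q ι E'') :
    autImageMap q ι hE hE'' (f ≫ g) = (autImageMap q ι hE' hE'' g).comp (autImageMap q ι hE hE' f) := by
  refine MonoidHom.ext fun x => Subtype.ext ?_
  rw [coe_autImageMap_of_le q ι hE hE'' (f ≫ g) (map_autImage_comp_le q ι hE hE' hE'' f g hf hg), MonoidHom.comp_apply,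
    coe_autImageMap_of_le q ι hE' hE'' g hg, coe_autImageMap_of_le q ι hE hE' f hf, map_comp q ι hE hE' hE'' f g]
  rfl

/-- **Functoriality of the image carrier along pairs with GALOIS targets** (for `q` onto): the root-codomain / `B_N^bs` locus of §5,
where every morphism carries images into images because the target image is everything.
[cite: MochizukiEtTh2009, Prop 5.5 proof p.328 (PDF p.102)] -/
theorem autImageMap_comp_of_isGaloisObj [IsTopologicalGroup G] (hG : IsTempered G) {E E' E'' : BTemp G} (hE : IsConnectedObj E)
    (hE' : IsGaloisObj E') (hE'' : IsGaloisObj E'') (hq : Function.Surjective q) (f : E ⟶ E') (g : E' ⟶ E'') :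
    autImageMap q ι hE hE''.1 (f ≫ g) = (autImageMap q ι hE'.1 hE''.1 g).comp (autImageMap q ι hE hE'.1 f) :=
  autImageMap_comp_of_le q ι hE hE'.1 hE''.1 f g
    (by rw [autImage_eq_top_of_isGaloisObj q ι hG E' hE' hq]; exact le_top)
    (by rw [autImage_eq_top_of_isGaloisObj q ι hG E'' hE'' hq]; exact le_top)

/-- `LDeltaMapId` for the stub `autImageStub q ι` over `B^temp(Π)⁰`. [cite: MochizukiEtTh2009, Prop 5.5 proof p.328 (PDF p.102)] -/
theorem autImageStub_lDeltaMap_id (E : ConnectedPart (BTemp G)) : (autImageStub q ι).lDeltaMap (𝟙 E) = MonoidHom.id _ :=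
  autImageMap_id q ι E.property

/-- Functoriality of the stub `autImageStub q ι` along composable pairs of `B^temp(Π)⁰` with Galois middle and final objects.
[cite: MochizukiEtTh2009, Prop 5.5 proof p.328 (PDF p.102)] -/
theorem autImageStub_lDeltaMap_comp_of_isGaloisObj [IsTopologicalGroup G] (hG : IsTempered G) {E E' E'' : ConnectedPart (BTemp G)}
    (hE' : IsGaloisObj E'.obj) (hE'' : IsGaloisObj E''.obj) (hq : Function.Surjective q) (f : E ⟶ E') (g : E' ⟶ E'') :
    (autImageStub q ι).lDeltaMap (f ≫ g) = ((autImageStub q ι).lDeltaMap g).comp ((autImageStub q ι).lDeltaMap f) :=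
  autImageMap_comp_of_isGaloisObj q ι hG E.property hE' hE'' hq f.hom g.hom

end ThetaSubquotient

end Literature.AnabelianGeometry.EtaleTheta

end
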